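import Summits.HodgeConjecture.HodgeConjecture.Theorems.HodgeLocusCensusTwistCells
import HarnessLib

/-!
# HodgeLocusCensusPlaneRank6 — PROVED: the period matrix of every coordinate 3-plane of the Fermat quartic sixfold has rank 19 = C(7,4) − 16 (cell pub-hlocus, LEAD gen 4, (T24))
HONEST FRAMING: certified instances and evidence bearing on the general Hodge conjecture; no claim.

Companion of `HodgeLocusCensusPlaneRank` ((4,4), rank 6) for the cell (6,4) of the open row r2: the EXPLAINED component NL(Π) = {quartic sixfolds
containing a ℙ³} has codimension h⁰(𝒪_{ℙ³}(4)) − dim G(4,8) = 35 − 16 = 19, and Movasati's 266 × 266 matrix [p_{i+j}([Π])] (rows and columns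
both indexed by I₄) has first-order rank 19. Kernel-PROVED for all 256 coordinate 3-planes Π = V(x_{2e} − ζ^{2a_{2e+1}+1}x_{2e+1}, e = 0..3)
(b = id): `ivhsRankEq_plane64 (a₁ a₃ a₅ a₇) : IvhsRankEq 6 4 19 [(1, plane64 a₁ a₃ a₅ a₇)]`, over every field of characteristic 0 and every
primitive 8th root ζ. MECHANISM (proved, `ivhsMatrix_plane64_eq_mul`): by `period_plane64` the entry (i,j) is nonzero iff the four pair sums of
i + j are all 2, and then splits as ζ^{Σ i_{2e}c_e} · ζ^{Σ (j_{2e}+1)c_e}; a row whose own pair-sum type σ(i) has a coordinate > 2 is ZERO, and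
the others fall into the 19 types σ ∈ {0,1,2}⁴ with |σ| = 4 — so M = U · V factors through K¹⁹ (⇒ rank ≤ 19), and the 19 × 19 minor on the rows
x^{σ} = (σ₀,0,σ₁,0,σ₂,0,σ₃,0) and columns (2−σ₀,0,2−σ₁,0,2−σ₂,0,2−σ₃,0) is DIAGONAL with unit entries (⇒ rank ≥ 19). Engine A numerics
(code/engineA/planerank/planerankA.py, data/ivhs/AS/A-planerank_4_6.json): rank 19 at both primes 1048601 / 1048609 for three sample planes.
-/

namespace Summit.HodgeConjecture.HodgeConjecture.HodgeLocus.Census.PlaneRank6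
open TwistCells GrSection

/-- the 19 pair-sum types σ ∈ {0,1,2}⁴, |σ| = 4, of a nonzero row (lexicographic), coordinate 0 … -/
def sig0 : Fin 19 → ℕ := ![0, 0, 0, 0, 0, 0, 1, 1, 1, 1, 1, 1, 1, 2, 2, 2, 2, 2, 2]
/-- … coordinate 1 … -/
def sig1 : Fin 19 → ℕ := ![0, 1, 1, 2, 2, 2, 0, 0, 1, 1, 1, 2, 2, 0, 0, 0, 1, 1, 2]
/-- … coordinate 2 … -/
def sig2 : Fin 19 → ℕ := ![2, 1, 2, 0, 1, 2, 1, 2, 0, 1, 2, 0, 1, 0, 1, 2, 0, 1, 0]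
/-- … coordinate 3. -/
def sig3 : Fin 19 → ℕ := ![2, 2, 1, 2, 1, 0, 2, 1, 2, 1, 0, 1, 0, 2, 1, 0, 1, 0, 0]

/-- the nineteen types are distinct … -/
theorem sig_inj : ∀ k k' : Fin 19, sig0 k = sig0 k' → sig1 k = sig1 k' → sig2 k = sig2 k' → sig3 k = sig3 k' → k = k' := by decide

/-- … have coordinates ≤ 2 … -/
theorem sig_le : ∀ k : Fin 19, sig0 k ≤ 2 ∧ sig1 k ≤ 2 ∧ sig2 k ≤ 2 ∧ sig3 k ≤ 2 := by decide

/-- … and exhaust {σ ∈ {0,1,2}⁴ : |σ| = 4}. -/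
theorem sig_cover : ∀ s0 ∈ Finset.range 3, ∀ s1 ∈ Finset.range 3, ∀ s2 ∈ Finset.range 3, ∀ s3 ∈ Finset.range 3,
    s0 + s1 + s2 + s3 = 4 → ∃ k : Fin 19, s0 = sig0 k ∧ s1 = sig1 k ∧ s2 = sig2 k ∧ s3 = sig3 k := by decide

/-- unbounded form of the cover. -/
theorem sig_cover' (s0 s1 s2 s3 : ℕ) (h0 : s0 ≤ 2) (h1 : s1 ≤ 2) (h2 : s2 ≤ 2) (h3 : s3 ≤ 2) (h : s0 + s1 + s2 + s3 = 4) :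
    ∃ k : Fin 19, s0 = sig0 k ∧ s1 = sig1 k ∧ s2 = sig2 k ∧ s3 = sig3 k :=
  sig_cover s0 (Finset.mem_range.mpr (by omega)) s1 (Finset.mem_range.mpr (by omega)) s2 (Finset.mem_range.mpr (by omega))
    s3 (Finset.mem_range.mpr (by omega)) h

/-- left factor U (rows × 19). -/
noncomputable def factorU {K : Type*} [Field K] (ζ : K) (a1 a3 a5 a7 : ℕ) : Matrix (indexSet 6 4 (6 / 2 * 4 - 6 - 2)) (Fin 19) K :=
  fun i k => if i.1 0 + i.1 1 = sig0 k ∧ i.1 2 + i.1 3 = sig1 k ∧ i.1 4 + i.1 5 = sig2 k ∧ i.1 6 + i.1 7 = sig3 k then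
    ζ ^ (i.1 0 * (1 + 2 * a1) + i.1 2 * (1 + 2 * a3) + i.1 4 * (1 + 2 * a5) + i.1 6 * (1 + 2 * a7)) else 0

/-- right factor V (19 × columns). -/
noncomputable def factorV {K : Type*} [Field K] (ζ : K) (a1 a3 a5 a7 : ℕ) : Matrix (Fin 19) (indexSet 6 4 4) K :=
  fun k j => if sig0 k + (j.1 0 + j.1 1) = 2 ∧ sig1 k + (j.1 2 + j.1 3) = 2 ∧ sig2 k + (j.1 4 + j.1 5) = 2 ∧ sig3 k + (j.1 6 + j.1 7) = 2 then
    ζ ^ ((j.1 0 + 1) * (1 + 2 * a1) + (j.1 2 + 1) * (1 + 2 * a3) + (j.1 4 + 1) * (1 + 2 * a5) + (j.1 6 + 1) * (1 + 2 * a7)) else 0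

/-- STRUCTURE THEOREM: M_[Π] = U · V through K¹⁹ (block-diagonal in the pair-sum type; rank-one blocks; rows of a type with a coordinate > 2 vanish). -/
theorem ivhsMatrix_plane64_eq_mul {K : Type*} [Field K] (ζ : K) (a1 a3 a5 a7 : ℕ) :
    ivhsMatrix 6 4 ζ [(1, plane64 a1 a3 a5 a7)] = factorU ζ a1 a3 a5 a7 * factorV ζ a1 a3 a5 a7 := by
  ext ⟨i, hi⟩ ⟨j, hj⟩
  rw [Matrix.mul_apply]
  by_cases hex : ∃ k : Fin 19, i 0 + i 1 = sig0 k ∧ i 2 + i 3 = sig1 k ∧ i 4 + i 5 = sig2 k ∧ i 6 + i 7 = sig3 k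
  · obtain ⟨k₀, h0, h1, h2, h3⟩ := hex
    rw [Finset.sum_eq_single k₀]
    · unfold ivhsMatrix periodComb factorU factorV
      simp only [List.map, List.sum_cons, List.sum_nil, Rat.cast_one, one_mul, add_zero, period_plane64]
      rw [if_pos (show i 0 + i 1 = sig0 k₀ ∧ i 2 + i 3 = sig1 k₀ ∧ i 4 + i 5 = sig2 k₀ ∧ i 6 + i 7 = sig3 k₀ from ⟨h0, h1, h2, h3⟩)]
      by_cases hc : sig0 k₀ + (j 0 + j 1) = 2 ∧ sig1 k₀ + (j 2 + j 3) = 2 ∧ sig2 k₀ + (j 4 + j 5) = 2 ∧ sig3 k₀ + (j 6 + j 7) = 2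
      · obtain ⟨c0, c1, c2, c3⟩ := hc
        rw [if_pos (show sig0 k₀ + (j 0 + j 1) = 2 ∧ sig1 k₀ + (j 2 + j 3) = 2 ∧ sig2 k₀ + (j 4 + j 5) = 2 ∧ sig3 k₀ + (j 6 + j 7) = 2 from
            ⟨c0, c1, c2, c3⟩),
          if_pos (show i 0 + j 0 + (i 1 + j 1) = 2 ∧ i 2 + j 2 + (i 3 + j 3) = 2 ∧ i 4 + j 4 + (i 5 + j 5) = 2 ∧ i 6 + j 6 + (i 7 + j 7) = 2 from
            ⟨by omega, by omega, by omega, by omega⟩), ← pow_add]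
        congr 1
        ring
      · rw [if_neg hc, mul_zero,
          if_neg (show ¬ (i 0 + j 0 + (i 1 + j 1) = 2 ∧ i 2 + j 2 + (i 3 + j 3) = 2 ∧ i 4 + j 4 + (i 5 + j 5) = 2 ∧ i 6 + j 6 + (i 7 + j 7) = 2) from
            fun h => hc ⟨by omega, by omega, by omega, by omega⟩)]
    · intro k _ hk
      unfold factorU
      rw [if_neg, zero_mul]
      intro h
      exact hk (sig_inj k k₀ (h.1.symm.trans h0) (h.2.1.symm.trans h1) (h.2.2.1.symm.trans h2) (h.2.2.2.symm.trans h3))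
    · intro h
      exact absurd (Finset.mem_univ k₀) h
  · -- a row of a type with some pair sum > 2: both sides vanish
    have hsum : i 0 + i 1 + i 2 + i 3 + i 4 + i 5 + i 6 + i 7 = 4 := by
      have h := (Finset.mem_filter.mp hi).2
      rw [Fin.sum_univ_eight] at h
      exact h
    have hU : ∀ k, factorU ζ a1 a3 a5 a7 ⟨i, hi⟩ k = 0 := fun k => by
      unfold factorU
      exact if_neg (fun h => hex ⟨k, h⟩)
    rw [Finset.sum_eq_zero (fun k _ => by rw [hU k, zero_mul])]
    unfold ivhsMatrix periodComb
    simp only [List.map, List.sum_cons, List.sum_nil, Rat.cast_one, one_mul, add_zero, period_plane64]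
    rw [if_neg]
    intro hc
    obtain ⟨c0, c1, c2, c3⟩ := hc
    exact hex (sig_cover' (i 0 + i 1) (i 2 + i 3) (i 4 + i 5) (i 6 + i 7) (by omega) (by omega) (by omega) (by omega) (by omega))

/-- UPPER BOUND: rank M_[Π] ≤ 19. -/
theorem rank_le_nineteen {K : Type*} [Field K] (ζ : K) (a1 a3 a5 a7 : ℕ) :
    (ivhsMatrix 6 4 ζ [(1, plane64 a1 a3 a5 a7)]).rank ≤ 19 := by
  rw [ivhsMatrix_plane64_eq_mul]
  exact (Matrix.rank_mul_le_left _ _).trans (by simpa using Matrix.rank_le_card_width (factorU ζ a1 a3 a5 a7))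

/-- … and sum to 4. -/
theorem sig_sum : ∀ k : Fin 19, sig0 k + sig1 k + sig2 k + sig3 k = 4 := by decide

/-- the witness rows x^{(σ₀,0,σ₁,0,σ₂,0,σ₃,0)} lie in I₄ … -/
theorem rowPick_mem (a : Fin 19) : (![sig0 a, 0, sig1 a, 0, sig2 a, 0, sig3 a, 0] : Fin 8 → ℕ) ∈ indexSet 6 4 (6 / 2 * 4 - 6 - 2) := by
  obtain ⟨l0, l1, l2, l3⟩ := sig_le a
  have hs := sig_sum a
  unfold indexSet
  simp only [Finset.mem_filter, Fintype.mem_piFinset, Finset.mem_range, Fin.forall_fin_succ, Fin.sum_univ_succ]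
  simp
  omega

/-- … and so do the witness columns x^{(2−σ₀,0,2−σ₁,0,2−σ₂,0,2−σ₃,0)}. -/
theorem colPick_mem (a : Fin 19) : (![2 - sig0 a, 0, 2 - sig1 a, 0, 2 - sig2 a, 0, 2 - sig3 a, 0] : Fin 8 → ℕ) ∈ indexSet 6 4 4 := by
  obtain ⟨l0, l1, l2, l3⟩ := sig_le a
  have hs := sig_sum a
  unfold indexSet
  simp only [Finset.mem_filter, Fintype.mem_piFinset, Finset.mem_range, Fin.forall_fin_succ, Fin.sum_univ_succ]
  simp
  omega

/-- the 19 witness rows … -/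
def rowPick (a : Fin 19) : indexSet 6 4 (6 / 2 * 4 - 6 - 2) := ⟨![sig0 a, 0, sig1 a, 0, sig2 a, 0, sig3 a, 0], rowPick_mem a⟩

/-- … and the 19 witness columns (complementary types). -/
def colPick (a : Fin 19) : indexSet 6 4 4 := ⟨![2 - sig0 a, 0, 2 - sig1 a, 0, 2 - sig2 a, 0, 2 - sig3 a, 0], colPick_mem a⟩

/-- the 19 × 19 witness minor is diagonal: off-diagonal entries vanish … -/
theorem minor_offdiag {K : Type*} [Field K] (ζ : K) (a1 a3 a5 a7 : ℕ) (a b : Fin 19) (hab : a ≠ b) :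
    ivhsMatrix 6 4 ζ [(1, plane64 a1 a3 a5 a7)] (rowPick a) (colPick b) = 0 := by
  unfold ivhsMatrix periodComb rowPick colPick
  simp only [List.map, List.sum_cons, List.sum_nil, Rat.cast_one, one_mul, add_zero, period_plane64,
    Matrix.cons_val_zero, Matrix.cons_val_one, Matrix.cons_val]
  rw [if_neg]
  intro hc
  obtain ⟨c0, c1, c2, c3⟩ := hc
  obtain ⟨la0, la1, la2, la3⟩ := sig_le a
  obtain ⟨lb0, lb1, lb2, lb3⟩ := sig_le b
  exact hab (sig_inj a b (by omega) (by omega) (by omega) (by omega))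

/-- … and the diagonal entries are powers of ζ, hence nonzero. -/
theorem minor_diag_ne_zero {K : Type*} [Field K] (ζ : K) (hz : ζ ≠ 0) (a1 a3 a5 a7 : ℕ) (a : Fin 19) :
    ivhsMatrix 6 4 ζ [(1, plane64 a1 a3 a5 a7)] (rowPick a) (colPick a) ≠ 0 := by
  unfold ivhsMatrix periodComb rowPick colPick
  simp only [List.map, List.sum_cons, List.sum_nil, Rat.cast_one, one_mul, add_zero, period_plane64,
    Matrix.cons_val_zero, Matrix.cons_val_one, Matrix.cons_val]
  obtain ⟨la0, la1, la2, la3⟩ := sig_le a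
  rw [if_pos ⟨by omega, by omega, by omega, by omega⟩]
  exact pow_ne_zero _ hz

/-- LOWER BOUND: rank M_[Π] ≥ 19 (the witness minor is a unit). -/
theorem nineteen_le_rank {K : Type*} [Field K] (ζ : K) (hz : ζ ≠ 0) (a1 a3 a5 a7 : ℕ) :
    19 ≤ (ivhsMatrix 6 4 ζ [(1, plane64 a1 a3 a5 a7)]).rank := by
  classical
  set M := ivhsMatrix 6 4 ζ [(1, plane64 a1 a3 a5 a7)] with hM
  have hS : M.submatrix rowPick colPick = Matrix.diagonal (fun a => M (rowPick a) (colPick a)) := by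
    ext a b
    by_cases hab : a = b
    · subst hab
      rw [Matrix.diagonal_apply_eq, Matrix.submatrix_apply]
    · rw [Matrix.diagonal_apply_ne _ hab, Matrix.submatrix_apply]
      exact minor_offdiag ζ a1 a3 a5 a7 a b hab
  have hdet : IsUnit (M.submatrix rowPick colPick).det := by
    rw [hS, Matrix.det_diagonal]
    exact isUnit_iff_ne_zero.mpr (Finset.prod_ne_zero_iff.mpr fun a _ => minor_diag_ne_zero ζ hz a1 a3 a5 a7 a)
  have hrank : (M.submatrix rowPick colPick).rank = 19 := by
    rw [Matrix.rank_of_isUnit _ ((Matrix.isUnit_iff_isUnit_det _).mpr hdet), Fintype.card_fin]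
  calc 19 = (M.submatrix rowPick colPick).rank := hrank.symm
    _ ≤ M.rank := Matrix.rank_submatrix_le M rowPick colPick

/-- PROVED ROW (all 256 coordinate 3-planes of the Fermat quartic sixfold): `IvhsRankEq 6 4 19 [Π]` — the first-order Hodge locus of a ℙ³ has
codimension 19 = 35 − 16 = codim {X ⊃ Π}. -/
theorem ivhsRankEq_plane64 (a1 a3 a5 a7 : ℕ) : IvhsRankEq 6 4 19 [(1, plane64 a1 a3 a5 a7)] := by
  intro K _ _ ζ hζ
  exact le_antisymm (rank_le_nineteen ζ a1 a3 a5 a7) (nineteen_le_rank ζ (hζ.ne_zero (by norm_num)) a1 a3 a5 a7)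

/-- the count 19 = C(7,4) − 4·4. -/
theorem plane64_codim_count : Nat.choose 7 4 - 4 * 4 = 19 := by decide

end Summit.HodgeConjecture.HodgeConjecture.HodgeLocus.Census.PlaneRank6
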